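import Summits.NavierStokesRegularity.NavierStokesRegularity.Theses.AxisymmetricExtremality
import Literature.Analysis.FluidPDE.RusinSverakBackwardRegularityHolds
import Literature.Analysis.FluidPDE.KNSSNoAxisymmetricTypeIHolds
import HarnessLib

/-!
# Seregin 2020, proof of Thm 2.1, the no-swirl endgame core: regularity at backward-bounded
# points up to the top time, and the enlarged clean radius

Helper toward the stub `stub_seregin2020TypeII` of the crux `AxisymmetricKatoGlobal` (= the named
fact `Literature.Analysis.FluidPDE.Seregin2020_axisymmetricSingularPoint_typeII`, G. Seregin,
Anal. Math. Phys. 10 (2020) Paper 46 = arXiv:2006.04140, Thm 2.1), last paragraph of the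
printed proof (arXiv p. 8), in the tree's rendering: the `η = ω_φ/ϱ` maximum principle at a
clean first singular point `(T, c)` of radius `R` of the backward-singular set
`Σ = {(t, x) | t ≤ 0, w ∉ L_∞(Q((t,x), r)) ∀ r > 0}` of a pair `(w, π)` in Albritton–Barker's
class on every `Q(a)`. Three inputs of that argument are recorded here:

* `isRegularPoint_of_backward_bounded` — a point `z` with `t < 0` at which `w` is essentially
  bounded on SOME backward cylinder is a regular point (centred regularity of backward-bounded
  interior points, `isRegularPoint_of_eLpNorm_parabolicCylinder_lt_top_holds`, inside a large
  ball `Q(a) ∋ z`);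
* `exists_norm_iteratedFDeriv_le_of_backward_bounded` — at a point `z` with `t ≤ 0` (the top time
  `0` allowed) at which `w` is essentially bounded on `Q(z, r)`, every continuous representative
  `V` of `w` on `Q(z, r)` has ALL spatial derivatives bounded on a smaller `Q(z, r')`, up to the
  top time (`NSBoundedHigherRegularity_holds`: uniform Hölder bounds on interior cylinders; the
  two continuous representatives agree everywhere);
* `exists_radius_gt_clean` — the clean-past property on the closed radius `R`
  ("`z ∈ Σ`, `dist x c ≤ R`, `T - R² ≤ t ≤ T` force `t = T`, `dist x c < R`") persists on an
  open radius `Rp > R` (`Σ` is closed: its part in the compact shell `R ≤ dist x c ≤ 2R` stays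
  away from the sphere `dist x c = R`).

## References

* G. Seregin, Anal. Math. Phys. 10 (2020), Paper 46 = arXiv:2006.04140, proof of Thm. 2.1, last
  paragraph (arXiv p. 8) and the structure of `S^Γ` (p. 7). [Seregin2020]
* G. Seregin, V. Šverák, Comm. PDE 34 (2009) = arXiv:0804.1803, §2 p. 8 (higher regularity of
  bounded solutions up to the top of the cylinder). [SereginSverak2009]
-/

-- the problem directory repeats the summit name (D-0017); core's `dupNamespace` linter fires
set_option linter.dupNamespace false

noncomputable section

open MeasureTheory Set Function Filter Topology TopologicalSpace Metric
open scoped NNReal ENNReal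

namespace Summit.NavierStokesRegularity.NavierStokesRegularity.Theorems.AxisymmetricKatoGlobal.EulerScaling

open Literature.Analysis.FluidPDE

variable {w : ℝ → EuclideanSpace ℝ (Fin 3) → EuclideanSpace ℝ (Fin 3)}
  {π : ℝ → EuclideanSpace ℝ (Fin 3) → ℝ}

/-! ### A large ball `Q(a)` around a backward cylinder of the closed lower half space -/

/-- For `t ≤ 0` and `0 < r`, the backward cylinder `Q((t, x), r)` lies in `Q(a) = Q((0,0), a)`
for `a = ‖x‖ + √(r² - t) + 1`. [folklore] -/
theorem parabolicCylinder_subset_parabolicCylinder_zero {z : ℝ × EuclideanSpace ℝ (Fin 3)}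
    (hz : z.1 ≤ 0) {r : ℝ} (hr : 0 < r) :
    0 < ‖z.2‖ + Real.sqrt (r ^ 2 - z.1) + 1 ∧
      parabolicCylinder r z ⊆
        parabolicCylinder (‖z.2‖ + Real.sqrt (r ^ 2 - z.1) + 1) (0 : ℝ × EuclideanSpace ℝ (Fin 3)) := by
  set a : ℝ := ‖z.2‖ + Real.sqrt (r ^ 2 - z.1) + 1 with ha
  have hapos : 0 < a := by positivity
  refine ⟨hapos, fun y hy => ?_⟩
  rw [mem_parabolicCylinder] at hy ⊢
  simp only [Prod.fst_zero, Prod.snd_zero, zero_sub, dist_zero_right]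
  have hsq : r ^ 2 - z.1 < a ^ 2 := by
    have h3 : Real.sqrt (r ^ 2 - z.1) < a := by rw [ha]; linarith [norm_nonneg z.2]
    have h4 : Real.sqrt (r ^ 2 - z.1) ^ 2 < a ^ 2 :=
      pow_lt_pow_left₀ h3 (Real.sqrt_nonneg _) two_ne_zero
    rwa [Real.sq_sqrt (by nlinarith)] at h4
  have hrs : r ≤ Real.sqrt (r ^ 2 - z.1) := by
    rw [Real.le_sqrt hr.le (by nlinarith)]; linarith
  refine ⟨⟨by linarith [hy.1.1], lt_of_lt_of_le hy.1.2 hz⟩, ?_⟩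
  calc ‖y.2‖ = dist y.2 0 := (dist_zero_right _).symm
    _ ≤ dist y.2 z.2 + dist z.2 0 := dist_triangle _ _ _
    _ < r + ‖z.2‖ := by rw [dist_zero_right]; linarith [hy.2]
    _ ≤ a := by rw [ha]; linarith

/-! ### Backward-bounded interior points are regular -/

/-- **A backward-bounded point below the top time is a regular point.** If `(w, π)` is an
Albritton–Barker suitable weak solution in every `Q(a)`, `z = (t, x)` has `t < 0` and
`w ∈ L_∞(Q(z, r))` for some `r > 0`, then `z` is a regular point of `w` (centred cylinders):
`z` is an interior point of a large `Q(a)`, inside which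
`isRegularPoint_of_eLpNorm_parabolicCylinder_lt_top_holds` applies to a small backward cylinder.
[cite: Seregin2020, proof of Thm 2.1, structure of S^Γ (arXiv p. 7)] -/
theorem isRegularPoint_of_backward_bounded
    (hball : ∀ a : ℝ, 0 < a → IsSuitableWeakSolutionInBall a 0 w π)
    {z : ℝ × EuclideanSpace ℝ (Fin 3)} (hlt : z.1 < 0) {r : ℝ} (hr : 0 < r)
    (hfin : eLpNorm (uncurry w) ∞ (volume.restrict (parabolicCylinder r z)) < ∞) :
    IsRegularPoint w z := by
  set a : ℝ := ‖z.2‖ + Real.sqrt (-z.1) + 1 with ha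
  have hapos : 0 < a := by positivity
  have hzQ : z ∈ (parabolicCylinderOpens a (0 : ℝ × EuclideanSpace ℝ (Fin 3)) : Set _) := by
    rw [coe_parabolicCylinderOpens, mem_parabolicCylinder]
    simp only [Prod.fst_zero, Prod.snd_zero, zero_sub, dist_zero_right]
    have h2 : -z.1 < a ^ 2 := by
      have h3 : Real.sqrt (-z.1) < a := by rw [ha]; linarith [norm_nonneg z.2]
      have h4 : Real.sqrt (-z.1) ^ 2 < a ^ 2 :=
        pow_lt_pow_left₀ h3 (Real.sqrt_nonneg _) two_ne_zero
      rwa [Real.sq_sqrt (by linarith)] at h4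
    exact ⟨⟨by linarith, hlt⟩, by rw [ha]; linarith [Real.sqrt_nonneg (-z.1)]⟩
  -- a small backward cylinder inside `Q(a)`
  obtain ⟨ε, hε, hεsub⟩ := Metric.isOpen_iff.1 (isOpen_parabolicCylinder a 0) z hzQ
  set r' : ℝ := min (min r ε) 1 with hr'
  have hr'pos : 0 < r' := lt_min (lt_min hr hε) one_pos
  have hr'r : r' ≤ r := (min_le_left _ _).trans (min_le_left _ _)
  have hr'ε : r' ≤ ε := (min_le_left _ _).trans (min_le_right _ _)
  have hr'1 : r' ≤ 1 := min_le_right _ _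
  have hQsub : parabolicCylinder r' z ⊆
      (parabolicCylinderOpens a (0 : ℝ × EuclideanSpace ℝ (Fin 3)) : Set _) := by
    intro y hy
    refine hεsub ?_
    rw [mem_parabolicCylinder] at hy
    rw [mem_ball, Prod.dist_eq, max_lt_iff, Real.dist_eq]
    have h1 : r' ^ 2 ≤ r' := by nlinarith
    refine ⟨?_, hy.2.trans_le hr'ε⟩
    rw [abs_lt]; constructor <;> linarith [hy.1.1, hy.1.2]
  have hfin' : eLpNorm (uncurry w) ∞ (volume.restrict (parabolicCylinder r' z)) < ∞ :=
    (eLpNorm_mono_measure _ (Measure.restrict_mono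
      (parabolicCylinder_mono hr'pos.le hr'r z) le_rfl)).trans_lt hfin
  exact isRegularPoint_of_eLpNorm_parabolicCylinder_lt_top_holds _ w π (hball a hapos).1 z hzQ
    r' hr'pos hQsub hfin'

/-! ### Bounded spatial derivatives up to the top time at a backward-bounded point -/

/-- **All spatial derivatives of a continuous representative are bounded near a
backward-bounded point, up to the top time.** Let `(w, π)` be an Albritton–Barker suitable weak
solution in every `Q(a)`, let `z = (t, x)` with `t ≤ 0` and `w ∈ L_∞(Q(z, r))`, `r > 0`, and let
`V` be continuous on `Q(z, r)` with `w = V` a.e. there. Then for every order `n` there are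
`r' > 0` and `K` with `‖D_xⁿ V(s, y)‖ ≤ K` on `Q(z, r')`: the representative of
`NSBoundedHigherRegularity_holds` on `Q(z, r₁) ⊆ Q(a)` has `D_xⁿ` uniformly Hölder — hence
bounded — on `Q(z, r₁/2)`, and agrees with `V` everywhere on `Q(z, r₁)` (two continuous
representatives). [cite: SereginSverak2009, §2 p. 8 (∇ᵏv Hölder continuous in Q̄₂ under (b8)–(b10))] -/
theorem exists_norm_iteratedFDeriv_le_of_backward_bounded :
    ∀ (w : ℝ → EuclideanSpace ℝ (Fin 3) → EuclideanSpace ℝ (Fin 3))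
      (π : ℝ → EuclideanSpace ℝ (Fin 3) → ℝ),
      (∀ a : ℝ, 0 < a → IsSuitableWeakSolutionInBall a 0 w π) →
      ∀ (z : ℝ × EuclideanSpace ℝ (Fin 3)) (r : ℝ), z.1 ≤ 0 → 0 < r →
      eLpNorm (uncurry w) ∞ (volume.restrict (parabolicCylinder r z)) < ∞ →
      ∀ (V : ℝ → EuclideanSpace ℝ (Fin 3) → EuclideanSpace ℝ (Fin 3)),
        ContinuousOn (uncurry V) (parabolicCylinder r z) →
        uncurry w =ᵐ[volume.restrict (parabolicCylinder r z)] uncurry V →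
        ∀ n : ℕ, ∃ r' > 0, ∃ K : ℝ, ∀ q ∈ parabolicCylinder r' z,
          ‖iteratedFDeriv ℝ n (V q.1) q.2‖ ≤ K := by
  intro w π hball z r hz hr hfin V hVc hae n
  -- ## the cylinder `Q(z, r)` inside a large `Q(a)`
  obtain ⟨hapos, hsub⟩ := parabolicCylinder_subset_parabolicCylinder_zero hz hr
  set a : ℝ := ‖z.2‖ + Real.sqrt (r ^ 2 - z.1) + 1 with ha
  obtain ⟨hsuit, -, -, hp⟩ := hball a hapos
  have hle : parabolicCylinderOpens r z ≤ parabolicCylinderOpens a (0 : ℝ × EuclideanSpace ℝ (Fin 3)) :=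
    fun q hq => hsub hq
  have hsol : IsDistributionalNSSolutionOn (parabolicCylinderOpens r z) 1 0 w π :=
    hsuit.distributional.of_le hle
  -- the essential bound
  set M : ℝ := (eLpNorm (uncurry w) ∞ (volume.restrict (parabolicCylinder r z))).toReal with hM
  have hbd : ∀ᵐ q ∂(volume.restrict (parabolicCylinder r z)), ‖w q.1 q.2‖ ≤ M := by
    filter_upwards [ae_le_eLpNormEssSup (f := uncurry w)
      (μ := volume.restrict (parabolicCylinder r z))] with q hq
    rw [← eLpNorm_exponent_top] at hq
    calc ‖w q.1 q.2‖ = ‖uncurry w q‖ₑ.toReal := (toReal_enorm _).symm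
      _ ≤ M := ENNReal.toReal_mono hfin.ne hq
  -- the pressure class
  have hp' : ∫⁻ q in parabolicCylinder r z, ‖π q.1 q.2‖ₑ ^ (3 / 2 : ℝ) < ∞ := by
    have h1 := hp.eLpNorm_lt_top
    have h32 : (3 / 2 : ℝ≥0∞) ≠ 0 := by simp
    have h32' : (3 / 2 : ℝ≥0∞) ≠ ∞ := ENNReal.div_ne_top (by simp) (by simp)
    rw [eLpNorm_lt_top_iff_lintegral_rpow_enorm_lt_top h32 h32'] at h1
    have e : ((3 / 2 : ℝ≥0∞)).toReal = (3 / 2 : ℝ) := by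
      rw [ENNReal.toReal_div]; norm_num
    rw [e] at h1
    exact (lintegral_mono_set hsub).trans_lt h1
  -- ## the smooth representative with uniform Hölder bounds
  obtain ⟨V', hae', -, hHol⟩ := NSBoundedHigherRegularity_holds w π z r M hsol hbd hp'
  have hV'c : ContinuousOn (uncurry V') (parabolicCylinder r z) :=
    continuousOn_uncurry_of_holder_exhaustion (hHol 0)
  -- `V = V'` everywhere on `Q(z, r)`
  have hEq : EqOn (uncurry V) (uncurry V') (parabolicCylinder r z) :=
    Measure.eqOn_open_of_ae_eq (hae.symm.trans hae') (isOpen_parabolicCylinder r z) hVc hV'c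
  -- ## the bound on `Q(z, r/2)`
  have hr2 : r / 2 ∈ Ioo 0 r := ⟨by positivity, by linarith⟩
  obtain ⟨C, α, hα, hH⟩ := hHol n (r / 2) hr2
  set q₀ : ℝ × EuclideanSpace ℝ (Fin 3) := (z.1 - (r / 2) ^ 2 / 2, z.2) with hq₀
  have hq₀Q : q₀ ∈ parabolicCylinder (r / 2) z := by
    rw [mem_parabolicCylinder, hq₀, dist_self]
    have : 0 < (r / 2) ^ 2 := by positivity
    exact ⟨⟨by linarith, by linarith⟩, by positivity⟩
  set D : ℝ := (r / 2) ^ 2 + r / 2 with hD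
  refine ⟨r / 2, by positivity, ‖iteratedFDeriv ℝ n (V' q₀.1) q₀.2‖ + C * D ^ (α : ℝ),
    fun q hq => ?_⟩
  have hsub2 : parabolicCylinder (r / 2) z ⊆ parabolicCylinder r z :=
    parabolicCylinder_mono (by positivity) (by linarith) z
  rw [iteratedFDeriv_slice_eq_of_eqOn (isOpen_parabolicCylinder r z) hEq n (hsub2 hq)]
  have hdist : dist q q₀ ≤ D := by
    rw [mem_parabolicCylinder] at hq
    rw [Prod.dist_eq, hq₀, Real.dist_eq, hD]
    refine max_le ?_ ?_
    · rw [abs_le]; constructor <;> nlinarith [hq.1.1, hq.1.2]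
    · linarith [hq.2, sq_nonneg (r / 2)]
  have h1 := hH.dist_le hq hq₀Q
  rw [dist_eq_norm] at h1
  have h2 : (C : ℝ) * dist q q₀ ^ (α : ℝ) ≤ C * D ^ (α : ℝ) :=
    mul_le_mul_of_nonneg_left (Real.rpow_le_rpow dist_nonneg hdist (NNReal.coe_nonneg α))
      (NNReal.coe_nonneg C)
  calc ‖iteratedFDeriv ℝ n (V' q.1) q.2‖
      ≤ ‖iteratedFDeriv ℝ n (V' q.1) q.2 - iteratedFDeriv ℝ n (V' q₀.1) q₀.2‖ +
          ‖iteratedFDeriv ℝ n (V' q₀.1) q₀.2‖ := norm_le_norm_sub_add _ _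
    _ ≤ ‖iteratedFDeriv ℝ n (V' q₀.1) q₀.2‖ + C * D ^ (α : ℝ) := by linarith

/-! ### The enlarged clean radius -/

/-- **The clean-past property persists on a slightly larger open radius.** Let `Σ` be closed and
let `(T, c)`, `R > 0` have the clean-past property: every `z ∈ Σ` with `dist z.2 c ≤ R` and
`T - R² ≤ z.1 ≤ T` has `z.1 = T` and `dist z.2 c < R`. Then the same holds with
`dist z.2 c ≤ R` replaced by `dist z.2 c < Rp` for some `Rp ∈ (R, 2R]`: the part of `Σ` in the
compact shell `[T - R², T] × {R ≤ dist x c ≤ 2R}` is compact and misses the sphere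
`dist x c = R`, so it stays at distance from it. [folklore] -/
theorem exists_radius_gt_clean {A : Set (ℝ × EuclideanSpace ℝ (Fin 3))} (hA : IsClosed A)
    {T : ℝ} {c : EuclideanSpace ℝ (Fin 3)} {R : ℝ} (hR : 0 < R)
    (hclean : ∀ z ∈ A, dist z.2 c ≤ R → T - R ^ 2 ≤ z.1 → z.1 ≤ T → z.1 = T ∧ dist z.2 c < R) :
    ∃ Rp : ℝ, R < Rp ∧ Rp ≤ 2 * R ∧
      ∀ z ∈ A, dist z.2 c < Rp → T - R ^ 2 ≤ z.1 → z.1 ≤ T → z.1 = T ∧ dist z.2 c < R := by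
  -- the part of `A` in the compact shell
  set F : Set (ℝ × EuclideanSpace ℝ (Fin 3)) :=
    A ∩ (Icc (T - R ^ 2) T ×ˢ (closedBall c (2 * R) \ ball c R)) with hF
  have hFc : IsCompact F := by
    refine (isCompact_Icc.prod ((isCompact_closedBall c (2 * R)).diff isOpen_ball)).of_isClosed_subset
      (hA.inter (isClosed_Icc.prod ((isClosed_closedBall).sdiff isOpen_ball))) inter_subset_right
  -- on `F`, `dist x c > R`
  have hFgt : ∀ z ∈ F, R < dist z.2 c := by
    rintro z ⟨hzA, hzt, hzx⟩
    have hRle : R ≤ dist z.2 c := by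
      have := hzx.2; rw [mem_ball, not_lt] at this; exact this
    rcases hRle.lt_or_eq with h | h
    · exact h
    · exact absurd (hclean z hzA h.symm.le hzt.1 hzt.2).2 (by rw [← h]; exact lt_irrefl R)
  by_cases hFe : F = ∅
  · refine ⟨2 * R, by linarith, le_rfl, fun z hz hd ht1 ht2 => ?_⟩
    by_cases hzR : dist z.2 c ≤ R
    · exact hclean z hz hzR ht1 ht2
    · exfalso
      have hzF : z ∈ F := ⟨hz, ⟨ht1, ht2⟩, mem_closedBall.2 hd.le, fun h => hzR (mem_ball.1 h).le⟩
      rw [hFe] at hzF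
      exact hzF
  · obtain ⟨z₀, hz₀, hmin⟩ := hFc.exists_isMinOn (nonempty_iff_ne_empty.2 hFe)
      (continuous_snd.dist continuous_const).continuousOn
    have hm : R < dist z₀.2 c := hFgt z₀ hz₀
    refine ⟨min (dist z₀.2 c) (2 * R), lt_min hm (by linarith), min_le_right _ _,
      fun z hz hd ht1 ht2 => ?_⟩
    by_cases hzR : dist z.2 c ≤ R
    · exact hclean z hz hzR ht1 ht2
    · exfalso
      have hd2 : dist z.2 c < 2 * R := hd.trans_le (min_le_right _ _)
      have hzF : z ∈ F := ⟨hz, ⟨ht1, ht2⟩, mem_closedBall.2 hd2.le, fun h => hzR (mem_ball.1 h).le⟩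
      have h1 : dist z₀.2 c ≤ dist z.2 c := hmin hzF
      linarith [hd.trans_le (min_le_left _ _)]

end Summit.NavierStokesRegularity.NavierStokesRegularity.Theorems.AxisymmetricKatoGlobal.EulerScaling

end
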